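import Mathlib
import HarnessLib
import Literature.AlgebraicGeometry.Resolution.StalkIdealLemmas
import Literature.AlgebraicGeometry.Resolution.PrimeDivisorIdeals
import Summits.ResolutionOfSingularities.ResolutionOfSingularities.Theorems.WildQuotientsWildQuotientResolutionToralEndState
import Summits.ResolutionOfSingularities.ResolutionOfSingularities.Theorems.WildQuotientsWildQuotientResolutionKSBlowupLocalChartCentre
import Summits.ResolutionOfSingularities.ResolutionOfSingularities.Theorems.WildQuotientsWildQuotientResolutionStubPointBlowupStalkData
import Summits.ResolutionOfSingularities.ResolutionOfSingularities.Theorems.WildQuotientsWildQuotientResolutionKSCentreEquivariantChart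

/-!
# Kollár–Szabó going down, (K2-centres), scheme side: the blow-up along a REGULAR stable centre through a regular
# point fixed by an abelian group has a fixed point over it with inertia
# (crux `WildQuotients.WildQuotientResolution`, stub `stub_phaseZeroHighDim`)

Crux stmt-ResolutionOfSingularities-15640 (`WildQuotientResolution`), registered stub `stub_phaseZeroHighDim`;
programme PHASE0-KS-EIGENLINE, item (K2-centres) — the POSITIVE-DIMENSIONAL CENTRE version of hand 8-g2's
✓`KSGoingDown.exists_fixedPoint_liftAction` (blow-up of the point `x`) and
✓`exists_fixedPoint_liftAction_of_normal_isPGroup_of_centre` (centres with `I_x = 𝔪_x`). ASSEMBLY of: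
✓`PointBlowupStalkData.exists_stalkAction` (the stalk action of `G = I_x`), ✓`InertLocusStalk.stalkAction_residueTrivial`,
the stability of the stalk `I_x` of a `G`-stable centre under the stalk action (the `hb`-argument of
✓`CentreBlowupStalkData.centreBlowupStalkData`: `a_g = stalkSpecializes ≫ (σ g)♯_x`, ✓`stalkIdeal_map_stalkSpecializes`,
✓`stalkIdeal_comap_eq_map_stalkMap`), hand 8-g3's ✓`CentreChart.exists_equivariant_monoidalTransform_of_action`
(p830814: the `σ`-stable REGULAR monoidal transform `R = S[J/t]_𝔫` at the stable normal hyperplane `[W]`), and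
✓`KSGoingDown.exists_fixedPoint_liftAction_of_localChart_of_stalkIdeal` (p829964: lift uniqueness on `Spec R → Bl_I X`):

* `stalkIdeal_stable_of_stalkAction` — for a `σ`-stable ideal sheaf `I` and the stalk action `a_g` of a subgroup
  fixing `x` (`Spec a_g ≫ ι_x = ι_x ≫ σ_g`): `a_g (I_x) ⊆ I_x`;
* ★ `exists_fixedPoint_liftAction_of_regularCentre` — **for an integral `X`, an ABELIAN `G` acting with `g ∈ I_x` for
  all `g` at a point `x` with `𝒪_{X,x}` regular and `κ(x)` algebraically closed, a `σ`-stable ideal sheaf `I` whose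
  stalk `I_x ≠ 0` is generated by PART OF A REGULAR SYSTEM OF PARAMETERS (the centre is regular at `x` and passes
  through it), and ANY blowing up `π : X' → X` along `I` with the LIFTED action: there is `x' ∈ X'` over `x` with
  `g ∈ I_{x'}` for every `g`** — together with its chart: a REGULAR local `R ⊆ Frac 𝒪_{X,x}` with injective local
  structure map, `I_x R = (t)`, the same residue field, and `φ : Spec R → X'` over `Spec R → X` sending the closed
  point to `x'`.

Not here (census): `𝒪_{X',x'} ≅ R` (so `x'` closed, regular, same dimension — the monoidal analogue of
✓`KSBlowupFixedPointStalk`/`…Centre`), and the p-closed (`I ⊵ P ⊇ [I,I]`) variant (swap in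
✓`CentreEigenline.exists_stable_hyperplane_of_normal_isPGroup`).

[OURS · crux stmt-ResolutionOfSingularities-15640 · helper toward `stub_phaseZeroHighDim` ((K2-centres) fixed point;
NOT a proof of the stub); counted 0; AI-level work, weaker than expert review.]
[cite: ReichsteinYoussin2000, Appendix (Kollár–Szabó), proof of Prop. A.2]
-/

-- single-problem summit: the doubled namespace component `ResolutionOfSingularities` is forced
set_option linter.dupNamespace false

noncomputable section

open CategoryTheory CategoryTheory.Limits AlgebraicGeometry TopologicalSpace IsLocalRing
open Literature.AlgebraicGeometry.Ramification Literature.AlgebraicGeometry.Resolution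
open Scheme.IdealSheafData
open Summit.ResolutionOfSingularities.ResolutionOfSingularities.Theorems.WildQuotientResolution

namespace Summit.ResolutionOfSingularities.ResolutionOfSingularities.Theorems.WildQuotientResolution.CentreChart

/-- **The stalk of a stable centre is stable under the stalk action.** Let `σ` act on `X`, `I` be a `σ`-stable
ideal sheaf (`σ_g⁻¹ I = I`), `H` a subgroup fixing `x`, and `a_g : 𝒪_{X,x} → 𝒪_{X,x}` stalk endomorphisms over the
action (`Spec a_g ≫ ι_x = ι_x ≫ σ_g`, the output of ✓`PointBlowupStalkData.exists_stalkAction`). Then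
`a_g (I_x) ⊆ I_x`: `a_g = stalkSpecializes ≫ (σ g)♯_x` (cancel the monomorphism `ι_x`), and both factors preserve
the stalks of `I`. [folklore] -/
theorem stalkIdeal_stable_of_stalkAction {X : Scheme.{0}} [IsIntegral X] {G : Type} [Group G]
    (σ : G →* Aut X) {x : X} (H : Subgroup G) (hH : ∀ g ∈ H, (σ g).hom.base x = x)
    (a : H → (X.presheaf.stalk x ⟶ X.presheaf.stalk x))
    (hkey : ∀ g : H, Spec.map (a g) ≫ X.fromSpecStalk x = X.fromSpecStalk x ≫ (σ (g : G)).hom)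
    {I : X.IdealSheafData} (hI : ∀ g, I.comap (σ g).hom = I) (g : H) :
    ∀ r ∈ stalkIdeal I x, (a g).hom r ∈ stalkIdeal I x := by
  -- adapted from `CentreBlowupStalkData.centreBlowupStalkData` (the `hb` step)
  have hfix : (σ (g : G)).hom.base x = x := hH g g.2
  have hb : a g = X.presheaf.stalkSpecializes (specializes_of_eq hfix) ≫ (σ (g : G)).hom.stalkMap x := by
    apply Spec.map_injective
    rw [← cancel_mono (X.fromSpecStalk x), hkey, Spec.map_comp, Category.assoc,
      Scheme.SpecMap_stalkSpecializes_fromSpecStalk, Scheme.SpecMap_stalkMap_fromSpecStalk]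
  intro r hr
  rw [hb, CommRingCat.hom_comp, RingHom.comp_apply]
  have h1 : (X.presheaf.stalkSpecializes (specializes_of_eq hfix)).hom r ∈
      stalkIdeal I ((σ (g : G)).hom.base x) := by
    rw [← stalkIdeal_map_stalkSpecializes I (specializes_of_eq hfix)]
    exact Ideal.mem_map_of_mem _ hr
  have h2 := Ideal.mem_map_of_mem ((σ (g : G)).hom.stalkMap x).hom h1
  rw [← stalkIdeal_comap_eq_map_stalkMap, hI] at h2
  exact h2

/-- **The fixed point of the blow-up along a regular stable centre (Kollár–Szabó going down, (K2-centres)).** Let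
`X` be an integral scheme, `G` an ABELIAN group acting on `X` with `g ∈ I_x` for all `g` at a point `x` whose local
ring is regular with algebraically closed residue field, `I` a `σ`-stable ideal sheaf whose stalk `I_x ≠ 0` is
generated by part `xs ∘ e` of a regular system of parameters `xs` of `𝒪_{X,x}` (a REGULAR centre through `x`), and
`π : X' → X` a blowing up along `I`, with the lifted action (✓`IsBlowup.liftAction`). Then there are a REGULAR local
subring `R ⊆ Frac 𝒪_{X,x}` with an injective local structure map `ι`, `I_x R = (t)` for some `t ≠ 0`, and the same
residue field — the equivariant monoidal transform at the stable normal hyperplane — a morphism `φ : Spec R → X'`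
over `Spec R → Spec 𝒪_{X,x} → X`, and the point `x' = φ(closed point) ∈ X'` over `x`, such that every `g` lies in
the inertia group of the lifted action at `x'`. [cite: ReichsteinYoussin2000, Appendix (Kollár–Szabó), proof of Prop. A.2] -/
theorem exists_fixedPoint_liftAction_of_regularCentre {X : Scheme.{0}} [IsIntegral X] {G : Type} [CommGroup G]
    (σ : G →* Aut X) {x : X} (hGx : ∀ g, g ∈ inertiaSubgroup σ x)
    [IsRegularLocalRing (X.presheaf.stalk x)] [IsAlgClosed (ResidueField (X.presheaf.stalk x))]
    {I : X.IdealSheafData} (hI : ∀ g, I.comap (σ g).hom = I)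
    {d m : ℕ} (hd : (maximalIdeal (X.presheaf.stalk x)).spanFinrank = d) (xs : Fin d → X.presheaf.stalk x)
    (hxs : Ideal.span (Set.range xs) = maximalIdeal (X.presheaf.stalk x))
    (e : Fin m → Fin d) (he : Function.Injective e)
    (hIx : stalkIdeal I x = Ideal.span (Set.range (xs ∘ e))) (hIx0 : stalkIdeal I x ≠ ⊥)
    {X' : Scheme.{0}} {π : X' ⟶ X} (hπ : IsBlowup π I) :
    ∃ (R : Subring (FractionRing (X.presheaf.stalk x))) (_ : IsLocalRing R)
      (ι : X.presheaf.stalk x →+* R) (_ : IsLocalHom ι) (t : R) (φ : Spec (.of R) ⟶ X') (x' : X'),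
      IsRegularLocalRing R ∧
      (∀ a, ((ι a : R) : FractionRing (X.presheaf.stalk x)) =
        algebraMap (X.presheaf.stalk x) (FractionRing (X.presheaf.stalk x)) a) ∧
      Function.Injective ι ∧ t ≠ 0 ∧ (stalkIdeal I x).map ι = Ideal.span {t} ∧
      (∀ r : R, ∃ a, ι a - r ∈ maximalIdeal R) ∧
      φ ≫ π = Spec.map (CommRingCat.ofHom ι) ≫ X.fromSpecStalk x ∧ φ (closedPoint R) = x' ∧ π x' = x ∧
      ∀ g, g ∈ inertiaSubgroup (hπ.liftAction σ hI) x' := by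
  -- adapted from hand 8-g2's `KSGoingDown.exists_fixedPoint_liftAction` (`{x} ↦` regular stable centre `I`)
  -- the stalk action of `G = I_x`, its residue-triviality and the stability of `I_x`
  obtain ⟨a, τ, hkey, hτ⟩ := PointBlowupStalkData.exists_stalkAction σ x (⊤ : Subgroup G)
    (fun g _ => apply_eq_of_mem_inertiaSubgroup σ (hGx g))
  have htop : (⊤ : Subgroup G) ≤ inertiaSubgroup σ x := fun g _ => hGx g
  have hresO : ∀ (g : (⊤ : Subgroup G)) (s : X.presheaf.stalk x), τ g s - s ∈ maximalIdeal _ :=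
    InertLocusStalk.stalkAction_residueTrivial σ x a τ hkey hτ htop
  have hstabI : ∀ (g : (⊤ : Subgroup G)), ∀ r ∈ stalkIdeal I x, (a g).hom r ∈ stalkIdeal I x :=
    stalkIdeal_stable_of_stalkAction σ ⊤ (fun g _ => apply_eq_of_mem_inertiaSubgroup σ (hGx g)) a hkey hI
  have hJτ : ∀ g : (⊤ : Subgroup G), ∀ r ∈ Ideal.span (Set.range (xs ∘ e)),
      τ g r ∈ Ideal.span (Set.range (xs ∘ e)) := by
    intro g r hr
    rw [← hIx] at hr ⊢
    rw [hτ]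
    exact hstabI g⁻¹ r hr
  have hJ0 : Ideal.span (Set.range (xs ∘ e)) ≠ ⊥ := hIx ▸ hIx0
  -- hand 8-g3: the equivariant monoidal transform
  obtain ⟨R, hRloc, ι, hιloc, t, α, hreg, hι, hιinj, ht0, hmap, hα, hres, hcong⟩ :=
    exists_equivariant_monoidalTransform_of_action hd xs hxs e he hJ0 τ hresO hJτ
  -- repackage over `G`
  let a' : G → (X.presheaf.stalk x ⟶ X.presheaf.stalk x) := fun g => a ⟨g, Subgroup.mem_top g⟩
  have hkey' : ∀ g, Spec.map (a' g) ≫ X.fromSpecStalk x = X.fromSpecStalk x ≫ (σ g).hom := fun g =>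
    hkey ⟨g, Subgroup.mem_top g⟩
  let α' : G → (R →+* R) := fun g => α ⟨g⁻¹, Subgroup.mem_top _⟩
  have hα' : ∀ g, (α' g).comp ι = ι.comp (a' g).hom := by
    intro g
    have hinv : (⟨g⁻¹, Subgroup.mem_top _⟩ : (⊤ : Subgroup G))⁻¹ = ⟨g, Subgroup.mem_top g⟩ :=
      Subtype.ext (inv_inv g)
    refine (hα ⟨g⁻¹, Subgroup.mem_top _⟩).trans ?_
    ext s
    change ((ι (τ ⟨g⁻¹, Subgroup.mem_top _⟩ s) : R) : FractionRing (X.presheaf.stalk x)) =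
      ((ι ((a ⟨g, Subgroup.mem_top g⟩).hom s) : R) : FractionRing (X.presheaf.stalk x))
    rw [hτ, hinv]
  have hres' : ∀ (g : G) (r : R), α' g r - r ∈ maximalIdeal R := fun g r => hres _ r
  have htnz : t ∈ nonZeroDivisors R := mem_nonZeroDivisors_of_ne_zero ht0
  have hmapI : (stalkIdeal I x).map ι = Ideal.span {t} := by rw [hIx]; exact hmap
  -- the local chart and its fixed point
  obtain ⟨φ, x', hφ, hφx', hx'x, hinert⟩ :=
    KSGoingDown.exists_fixedPoint_liftAction_of_localChart_of_stalkIdeal hπ σ hI a' hkey' ι htnz hmapI α'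
      hα' hres'
  exact ⟨R, hRloc, ι, hιloc, t, φ, x', hreg, hι, hιinj, ht0, hmapI, hcong, hφ, hφx', hx'x, hinert⟩

end Summit.ResolutionOfSingularities.ResolutionOfSingularities.Theorems.WildQuotientResolution.CentreChart

end
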